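import Summits.Schanuel.Schanuel.Theorems.SoloInformedRoyBandProduct
import Summits.Schanuel.Schanuel.Theorems.SoloInformedRoyTranslateSharp

/-!
# Roy's criterion is carried by an `ε`-thin band of translates

**Band criterion.** For every `ε > 0` there are parameters `(s₀, s₁, t₀, t₁, u)` in Roy's window
(1) (`RoyAdmissible`) such that for all `(y, α) ∈ ℂ × ℂˣ`:

  `α^d = e^{dy}` for some `d ≥ 1`  **iff**  for all large `N` there is `Q_N ≠ 0`,
  `deg Q_N ≤ (N^{t₀}, N^{t₁})`, `H(Q_N) ≤ e^N`, with `|(D^kQ_N)(my, α^m)| ≤ e^{-N^u}` for all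
  `k ≤ N^{s₀}` and all `m` in the BAND `N^{s₁-ε} < m ≤ N^{s₁}`

(`roy_band_criterion`; corner `t₀ = 1-η`, `t₁ = ½-η`, `s₀ = 1+η`, `s₁ = ½+η`, `u = 1+2η`,
`η = min(ε,½)/13`).  This strictly strengthens Roy 2001, Theorem 1 ((b) ⇒ band-(b) trivially) and
complements the no-go results of this series: smallness at any single translate is free
(`SoloInformedRoySinglePoint*`), smallness at all translates `m ≤ N^{s₁-ε}` is free
(`SoloInformedRoyTranslateSharp`), while the top band alone is already equivalent to (a).
In Dirichlet-exponent terms: a translate set of `≍ N^σ` points `m ≤ N^{s₁}` is free as soon as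
`s₀ + σ + u < 1 + t₀ + t₁` (with the size conditions H3–H5), and the window (1) forces
`s₀ + s₁ + u > 1 + t₀ + t₁` by a margin that vanishes at the corner — so the content of (b) sits
exactly where the box principle stops paying, in the last `N^{O(η)}` factor of translates.

Proof: low range free (`royConditionB_of_lt`) + product step
(`eventually_exists_small_of_band_of_low`) + rescaling `N ↦ ⌊N^θ⌋`
(`royConditionB_of_rescaled`, here) + Roy's Theorem 1 at slightly shrunken admissible
parameters (`Roy2001_thm1_holds`).

References: D. Roy, Acta Arith. 97 (2001), Thm. 1 [Roy2001]; M. Waldschmidt, Springer 2000, §4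
[Waldschmidt2000].
-/

noncomputable section

open MvPolynomial Filter Complex Metric
open Literature.NumberTheory.Transcendental

namespace Summit.Schanuel.Schanuel.Theorems

/-! ### The rescaling step -/

/-- **Rescaling step.** A sequence `P_N ≠ 0` with `deg ≤ (2N^{t₀}, 2N^{t₁})`, `H ≤ e^{cN}` and
`|(D^kP_N)(my, α^m)| ≤ e^{-N^u/2}` (`k ≤ N^{s₀}`, `m ≤ N^{s₁}`) yields condition (b) at any
`(s₀', s₁', t₀, t₁, u')` with `s₀' < θs₀`, `s₁' < θs₁`, `u' < θu`, `0 < θ < 1`: take `Q_{N'} = P_n`,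
`n = ⌊N'^θ⌋`. [folklore] -/
theorem royConditionB_of_rescaled (y α : ℂ) {s₀ s₁ t₀ t₁ u s₀' s₁' u' θ c : ℝ}
    (ht₀ : 0 < t₀) (ht₁ : 0 < t₁) (hs₀ : 0 < s₀) (hs₁ : 0 < s₁) (hu : 0 < u)
    (hθ0 : 0 < θ) (hθ1 : θ < 1) (hθs₀ : s₀' < θ * s₀) (hθs₁ : s₁' < θ * s₁) (hθu : u' < θ * u)
    (hc : 0 ≤ c)
    (h : ∀ᶠ N : ℕ in atTop, ∃ P : MvPolynomial (Fin 2) ℤ, P ≠ 0 ∧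
      (P.degreeOf 0 : ℝ) ≤ 2 * (N : ℝ) ^ t₀ ∧ (P.degreeOf 1 : ℝ) ≤ 2 * (N : ℝ) ^ t₁ ∧
      (mvPolyHeight P : ℝ) ≤ Real.exp (c * N) ∧
      ∀ k m : ℕ, (k : ℝ) ≤ (N : ℝ) ^ s₀ → (m : ℝ) ≤ (N : ℝ) ^ s₁ →
        ‖aeval ![(m : ℂ) * y, α ^ m] (royD^[k] P)‖ ≤ Real.exp (-(N : ℝ) ^ u / 2)) :
    RoyConditionB y α s₀' s₁' t₀ t₁ u' := by
  unfold RoyConditionB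
  have hφ : Tendsto (fun N' : ℕ => ⌊(N' : ℝ) ^ θ⌋₊) atTop atTop :=
    tendsto_nat_floor_atTop.comp ((tendsto_rpow_atTop hθ0).comp tendsto_natCast_atTop_atTop)
  have hP := hφ.eventually h
  have E0 : ∀ᶠ x : ℝ in atTop, 2 ≤ x ^ θ := (tendsto_rpow_atTop hθ0).eventually_ge_atTop 2
  have E1 := eventually_mul_rpow_le_mul_rpow 2 (show θ * t₀ < t₀ by nlinarith) one_pos
  have E2 := eventually_mul_rpow_le_mul_rpow 2 (show θ * t₁ < t₁ by nlinarith) one_pos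
  have E3 := eventually_mul_rpow_le_mul_rpow c hθ1 one_pos
  have E4 := eventually_mul_rpow_le_mul_rpow ((2 : ℝ) ^ s₀) hθs₀ one_pos
  have E5 := eventually_mul_rpow_le_mul_rpow ((2 : ℝ) ^ s₁) hθs₁ one_pos
  have E6 := eventually_mul_rpow_le_mul_rpow (2 * (2 : ℝ) ^ u) hθu one_pos
  have hreal : ∀ᶠ x : ℝ in atTop, 1 ≤ x ∧ 2 ≤ x ^ θ ∧ 2 * x ^ (θ * t₀) ≤ 1 * x ^ t₀ ∧
      2 * x ^ (θ * t₁) ≤ 1 * x ^ t₁ ∧ c * x ^ θ ≤ 1 * x ^ (1 : ℝ) ∧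
      (2 : ℝ) ^ s₀ * x ^ s₀' ≤ 1 * x ^ (θ * s₀) ∧ (2 : ℝ) ^ s₁ * x ^ s₁' ≤ 1 * x ^ (θ * s₁) ∧
      2 * (2 : ℝ) ^ u * x ^ u' ≤ 1 * x ^ (θ * u) := by
    filter_upwards [eventually_ge_atTop 1, E0, E1, E2, E3, E4, E5, E6]
      with x h1 h0 e1 e2 e3 e4 e5 e6
    exact ⟨h1, h0, e1, e2, e3, e4, e5, e6⟩
  filter_upwards [hP, tendsto_natCast_atTop_atTop.eventually hreal] with N hPN hN
  obtain ⟨P, hP0, hd0, hd1, hH, hsmall⟩ := hPN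
  obtain ⟨hx1, hx2, e1, e2, e3, e4, e5, e6⟩ := hN
  set x : ℝ := (N : ℝ) with hx
  set n : ℕ := ⌊x ^ θ⌋₊ with hn
  have hx0 : 0 < x := one_pos.trans_le hx1
  have hxθ0 : 0 ≤ x ^ θ := Real.rpow_nonneg hx0.le θ
  have hnle : (n : ℝ) ≤ x ^ θ := Nat.floor_le hxθ0
  have hnge : x ^ θ / 2 ≤ n := by
    have := Nat.lt_floor_add_one (x ^ θ)
    linarith
  have hn0 : (0 : ℝ) ≤ n := Nat.cast_nonneg n
  have hnt₀ : (n : ℝ) ^ t₀ ≤ x ^ (θ * t₀) := by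
    rw [Real.rpow_mul hx0.le]
    exact Real.rpow_le_rpow hn0 hnle ht₀.le
  have hnt₁ : (n : ℝ) ^ t₁ ≤ x ^ (θ * t₁) := by
    rw [Real.rpow_mul hx0.le]
    exact Real.rpow_le_rpow hn0 hnle ht₁.le
  have hlow : ∀ {s : ℝ}, 0 ≤ s → x ^ (θ * s) ≤ (2 : ℝ) ^ s * (n : ℝ) ^ s := by
    intro s hs
    have h1 : (x ^ θ / 2) ^ s ≤ (n : ℝ) ^ s := Real.rpow_le_rpow (by positivity) hnge hs
    rw [Real.div_rpow hxθ0 zero_le_two, ← Real.rpow_mul hx0.le,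
      div_le_iff₀ (by positivity)] at h1
    linarith
  have hns₀ : x ^ s₀' ≤ (n : ℝ) ^ s₀ := by
    have h3 : (2 : ℝ) ^ s₀ * x ^ s₀' ≤ (2 : ℝ) ^ s₀ * (n : ℝ) ^ s₀ := by
      linarith [hlow hs₀.le]
    exact le_of_mul_le_mul_left h3 (by positivity)
  have hns₁ : x ^ s₁' ≤ (n : ℝ) ^ s₁ := by
    have h3 : (2 : ℝ) ^ s₁ * x ^ s₁' ≤ (2 : ℝ) ^ s₁ * (n : ℝ) ^ s₁ := by
      linarith [hlow hs₁.le]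
    exact le_of_mul_le_mul_left h3 (by positivity)
  have hnu : x ^ u' ≤ (n : ℝ) ^ u / 2 := by
    have h3 : (2 : ℝ) ^ u * (2 * x ^ u') ≤ (2 : ℝ) ^ u * (n : ℝ) ^ u := by
      nlinarith [hlow hu.le]
    have h4 := le_of_mul_le_mul_left h3 (by positivity)
    linarith
  refine ⟨P, hP0, ?_, ?_, ?_, ?_⟩
  · calc (P.degreeOf 0 : ℝ) ≤ 2 * (n : ℝ) ^ t₀ := hd0
      _ ≤ 2 * x ^ (θ * t₀) := by linarith [hnt₀]
      _ ≤ x ^ t₀ := by linarith [e1]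
  · calc (P.degreeOf 1 : ℝ) ≤ 2 * (n : ℝ) ^ t₁ := hd1
      _ ≤ 2 * x ^ (θ * t₁) := by linarith [hnt₁]
      _ ≤ x ^ t₁ := by linarith [e2]
  · refine hH.trans (Real.exp_le_exp.2 ?_)
    calc c * (n : ℝ) ≤ c * x ^ θ := mul_le_mul_of_nonneg_left hnle hc
      _ ≤ 1 * x ^ (1 : ℝ) := e3
      _ = x := by rw [one_mul, Real.rpow_one]
  · intro k m hk hm
    refine (hsmall k m (hk.trans hns₀) (hm.trans hns₁)).trans (Real.exp_le_exp.2 ?_)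
    linarith [hnu]

/-! ### The band criterion -/

/-- Corner arithmetic for the band criterion. [folklore] -/
theorem band_corner_facts {η : ℝ} (hη0 : 0 < η) (hη : η ≤ 1 / 26) :
    1 + η / 2 < (1 - η / 4) * (1 + η) ∧ 1 / 2 + η / 2 < (1 - η / 4) * (1 / 2 + η) ∧
      1 + 3 * η / 2 < (1 - η / 4) * (1 + 2 * η) := by
  refine ⟨by nlinarith, by nlinarith, by nlinarith⟩

/-- **Band criterion.** For every `ε > 0` there are Roy-admissible parameters such that, for
all `(y, α)` with `α ≠ 0`, condition (b) of Roy's Theorem 1 RESTRICTED TO THE BAND of translates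
`N^{s₁-ε} < m ≤ N^{s₁}` is equivalent to condition (a) `∃ d ≥ 1, α^d = e^{dy}`.
(`t₀ = 1-η`, `t₁ = ½-η`, `s₀ = 1+η`, `s₁ = ½+η`, `u = 1+2η`, `η = min(ε,½)/13`.)
[cite: Roy2001, Thm. 1; folklore (Dirichlet)] -/
theorem roy_band_criterion (ε : ℝ) (hε : 0 < ε) :
    ∃ s₀ s₁ t₀ t₁ u : ℝ, RoyAdmissible s₀ s₁ t₀ t₁ u ∧ ∀ y α : ℂ, α ≠ 0 →
      ((∀ᶠ N : ℕ in atTop, ∃ Q : MvPolynomial (Fin 2) ℤ, Q ≠ 0 ∧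
        (Q.degreeOf 0 : ℝ) ≤ (N : ℝ) ^ t₀ ∧ (Q.degreeOf 1 : ℝ) ≤ (N : ℝ) ^ t₁ ∧
        (mvPolyHeight Q : ℝ) ≤ Real.exp N ∧
        ∀ k m : ℕ, (k : ℝ) ≤ (N : ℝ) ^ s₀ → (N : ℝ) ^ (s₁ - ε) < m → (m : ℝ) ≤ (N : ℝ) ^ s₁ →
          ‖aeval ![(m : ℂ) * y, α ^ m] (royD^[k] Q)‖ ≤ Real.exp (-(N : ℝ) ^ u)) ↔
        RoyConditionA y α) := by
  set ε' : ℝ := min ε (1 / 2) with hε'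
  have hε'0 : 0 < ε' := lt_min hε (by norm_num)
  have hε'1 : ε' ≤ 1 / 2 := min_le_right _ _
  have hε'ε : ε' ≤ ε := min_le_left _ _
  set η : ℝ := ε' / 13 with hη
  have hη0 : 0 < η := by rw [hη]; positivity
  have hη13 : 13 * η = ε' := by rw [hη]; ring
  have hη26 : η ≤ 1 / 26 := by rw [hη]; linarith
  obtain ⟨c₁, c₂, c₃⟩ := band_corner_facts hη0 hη26
  have hadm : RoyAdmissible (1 + η) (1 / 2 + η) (1 - η) (1 / 2 - η) (1 + 2 * η) :=
    royAdmissible_iff.mpr ⟨⟨by linarith, by linarith, by linarith, by linarith, by linarith⟩,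
      ⟨by linarith, by linarith, by linarith, by linarith, by linarith, by linarith⟩,
      ⟨by linarith, by linarith, by linarith⟩⟩
  have hadm' : RoyAdmissible (1 + η / 2) (1 / 2 + η / 2) (1 - η) (1 / 2 - η) (1 + 3 * η / 2) :=
    royAdmissible_iff.mpr ⟨⟨by linarith, by linarith, by linarith, by linarith, by linarith⟩,
      ⟨by linarith, by linarith, by linarith, by linarith, by linarith, by linarith⟩,
      ⟨by linarith, by linarith, by linarith⟩⟩
  refine ⟨1 + η, 1 / 2 + η, 1 - η, 1 / 2 - η, 1 + 2 * η, hadm, ?_⟩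
  intro y α hα
  constructor
  · intro hband
    have hlow : RoyConditionB y α (1 + η) (1 / 2 + η - ε') (1 - η) (1 / 2 - η) (1 + 2 * η) :=
      royConditionB_of_lt y α (by linarith) (by linarith) (by linarith) (by linarith)
        (by linarith) (by linarith) (by linarith) (by linarith) (by linarith)
    have hprod := eventually_exists_small_of_band_of_low y α (sL := 1 / 2 + η - ε)
      (sL' := 1 / 2 + η - ε') (by linarith) (by linarith) (by linarith) (by linarith)
      (by linarith) (by linarith) (by linarith) (by linarith) (by linarith) hlow hband
    have hB' : RoyConditionB y α (1 + η / 2) (1 / 2 + η / 2) (1 - η) (1 / 2 - η)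
        (1 + 3 * η / 2) :=
      royConditionB_of_rescaled y α (θ := 1 - η / 4) (by linarith) (by linarith) (by linarith)
        (by linarith) (by linarith) (by linarith) (by linarith) c₁ c₂ c₃ (by linarith) hprod
    exact (Roy2001_thm1_holds y α hα _ _ _ _ _ hadm').mpr hB'
  · intro hA
    have hB := (Roy2001_thm1_holds y α hα _ _ _ _ _ hadm).mp hA
    unfold RoyConditionB at hB
    filter_upwards [hB] with N ⟨Q, hQ0, h0, h1, hH, hsm⟩
    exact ⟨Q, hQ0, h0, h1, hH, fun k m hk _ hm => hsm k m hk hm⟩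

end Summit.Schanuel.Schanuel.Theorems

end
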